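import Summits.NavierStokesRegularity.OSWSelfSimilar.SheetNSLineTorusCascadeSuperTail
import HarnessLib

/-!
# Viscous CLM on the torus (`a = 0`, `σ = 2`): the MOVING-POLE SUPER-SOLUTION — a time-dependent pole bound `B k ρ(t)^{−k}` on
# all high modes from pointwise bounds on finitely many modes (kernel half of the time-dependent global-existence certificate)

HONEST FRAMING (cell ns-blowup GROUP B «PROFILE SEARCH», zone Z3, row Z3-U addendum A-F2 of `HOME/profile/z3/CENSUS-Z3.md`;
human rulings D-0035/D-0074): **1-D MODEL (viscous Constantin–Lax–Majda equation `ω_t = ω Hω + ν ω_xx` on `𝕋 = ℝ/2πℤ`);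
ODE calculus on Fourier-coefficient families, kernel-checked; not Euler, not Navier–Stokes; «violates: none — MODEL».**

OBJECT: the sine-datum cascade `IsSineCascade ν c e` (`SheetNSLineTorusCascade`). `SheetNSLineTorusCascadeSuperTail` propagated
TIME-UNIFORM bounds; since the true analyticity radius `R(t)` of the solution grows after its minimum, a time-uniform tail is
useless at late times. HERE the pole radius moves: for a positive differentiable `ρ` on `[0, T]` with logarithmic growth rate
`ρ′/ρ ≤ νg`, pointwise bounds `e_j(s) ≤ V_j(s)` (`j ≤ K₀`) with excesses `V_j(s)ρ(s)^j ≤ Bj + X_j(s)`, `Σ_{j≤K₀} X_j(s) ≤ E`, and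
the single condition `B/(12ν) + E/(ν(K₀+1)²) + E²/(2Bν(K₀+1)³) + g/(K₀+1) ≤ 1` imply

* `movingPole_tail_induction` — **`e_k(t) ≤ B k ρ(t)^{−k}` for EVERY `k > K₀`, `t ∈ [0, T]`**

(ODE comparison: `e^{νk²t}(B k ρ^{−k} − e_k)` is non-decreasing, using `conv_pole_excess_le` at each instant). USE (certificate,
`HOME/profile/z3/SHEET.md` §15): validated pointwise bounds `V_j` (`j ≤ K₀`) and a grid-built `ρ` tracking the certified pole radius
give `Σ_k c^k e_k(t) < ∞` on `[0, T]` for `c < min_t ρ(t)` and a tail small enough at `T` for the Riccati hand-over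
(`IsNonnegCascade.partialSum_le_riccati`). bears_on: LADDER-NS N5 / zone Z3 (row Z3-U) → N1 linear core. WHAT THIS IS NOT: not NS;
`V`, `X`, `ρ` are certified-numerics INPUTS (a piecewise-linear grid radius is replaced by a `C¹` minorant with the same growth
bound — pen); sine datum only. No definitions.
-/

namespace Summit.NavierStokesRegularity.OSWSelfSimilar
namespace SheetNSLineTorusCascade

open Finset Real Set

variable {ν c : ℝ} {e : ℕ → ℝ → ℝ}

/-- **MOVING-POLE TAIL INDUCTION.** See the module docstring for the hypotheses; conclusion: `e_k(t) ≤ B k ρ(t)^{−k}` for all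
`k > K₀`, `t ∈ [0, T]`. [new here — MODEL] -/
theorem movingPole_tail_induction (he : IsSineCascade ν c e) (hν : 0 < ν) (hc : 0 ≤ c) {K₀ : ℕ} (hK₀ : 1 ≤ K₀)
    {T B E g : ℝ} (hB : 0 < B) (hE : 0 ≤ E) (hg : 0 ≤ g)
    {ρ ρ' : ℝ → ℝ} (hρpos : ∀ t ∈ Icc 0 T, 0 < ρ t) (hρcont : ContinuousOn ρ (Icc 0 T))
    (hρder : ∀ t ∈ Ioo 0 T, HasDerivAt ρ (ρ' t) t) (hρ' : ∀ t ∈ Ioo 0 T, ρ' t ≤ ν * g * ρ t)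
    {V X : ℕ → ℝ → ℝ} (hV0 : ∀ j s, 0 ≤ V j s) (hX0 : ∀ j s, 0 ≤ X j s)
    (hVe : ∀ j, j ≤ K₀ → ∀ s ∈ Icc 0 T, e j s ≤ V j s)
    (hVX : ∀ j, j ≤ K₀ → ∀ s ∈ Icc 0 T, V j s * ρ s ^ j ≤ B * (j : ℝ) + X j s)
    (hXE : ∀ s ∈ Icc 0 T, ∑ j ∈ range (K₀ + 1), X j s ≤ E)
    (hcond : B / (12 * ν) + E / (ν * ((K₀ : ℝ) + 1) ^ 2) + E ^ 2 / (2 * B * ν * ((K₀ : ℝ) + 1) ^ 3) + g / ((K₀ : ℝ) + 1) ≤ 1) :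
    ∀ k : ℕ, K₀ < k → ∀ t ∈ Icc 0 T, e k t ≤ B * (k : ℝ) * (ρ t ^ k)⁻¹ := by
  intro k
  induction k using Nat.strong_induction_on with
  | _ k ih =>
    intro hk t ht
    have hk1 : 1 ≤ k := by omega
    have hk2 : 2 ≤ k := by omega
    have hk0 : (0 : ℝ) < k := by exact_mod_cast (show 0 < k by omega)
    have hkK : ((K₀ : ℝ) + 1) ≤ k := by exact_mod_cast hk
    have hK1 : (0 : ℝ) < (K₀ : ℝ) + 1 := by positivity
    rcases ht.1.eq_or_lt with h0 | htpos
    · -- t = 0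
      rw [← h0, he.init_zero k hk2]
      have := hρpos 0 ⟨le_rfl, h0 ▸ ht.2⟩
      positivity
    have hT : 0 < T := lt_of_lt_of_le htpos ht.2
    -- the comparison function φ(s) = B k e^{νk²s} (ρ s ^ k)⁻¹ − e^{νk²s} e_k s on [0, T]
    -- the per-instant convolution bound
    have hconv : ∀ s ∈ Ioo 0 T, ∑ p ∈ antidiagonal k, e p.1 s * e p.2 s
        ≤ (ρ s ^ k)⁻¹ * (B ^ 2 * (((k : ℝ) ^ 3 - k) / 6) + 2 * B * (k : ℝ) * E + E ^ 2) := by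
      intro s hs
      have hsI : s ∈ Icc 0 T := ⟨hs.1.le, hs.2.le⟩
      have hρs : 0 < ρ s := hρpos s hsI
      set Ub : ℕ → ℝ := fun i => if i ≤ K₀ then V i s else B * (i : ℝ) * (ρ s ^ i)⁻¹ with hUb
      set Xb : ℕ → ℝ := fun i => if i ≤ K₀ then X i s else 0 with hXb
      have hUb0 : ∀ i, i ≤ k → 0 ≤ Ub i := by
        intro i _; simp only [hUb]; split_ifs
        · exact hV0 i s
        · positivity
      have hXb0 : ∀ i, i ≤ k → 0 ≤ Xb i := by
        intro i _; simp only [hXb]; split_ifs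
        · exact hX0 i s
        · exact le_rfl
      have hUXb : ∀ i, i ≤ k → Ub i * ρ s ^ i ≤ B * (i : ℝ) + Xb i := by
        intro i _; simp only [hUb, hXb]; split_ifs with h
        · exact hVX i h s hsI
        · rw [add_zero]
          have : B * (i : ℝ) * (ρ s ^ i)⁻¹ * ρ s ^ i = B * (i : ℝ) := by field_simp
          rw [this]
      have hlow : ∀ i, i < k → e i s ≤ Ub i := by
        intro i hi
        simp only [hUb]; split_ifs with h
        · exact hVe i h s hsI
        · exact ih i hi (by omega) s hsI
      have h1 : ∑ p ∈ antidiagonal k, e p.1 s * e p.2 s ≤ ∑ p ∈ antidiagonal k, Ub p.1 * Ub p.2 := by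
        refine sum_le_sum fun p hp => ?_
        have hsum : p.1 + p.2 = k := mem_antidiagonal.mp hp
        rcases Nat.eq_zero_or_pos p.1 with h0 | h0
        · rw [h0, he.zero, zero_mul]; exact mul_nonneg (hUb0 0 (by omega)) (hUb0 p.2 (by omega))
        rcases Nat.eq_zero_or_pos p.2 with h0' | h0'
        · rw [h0', he.zero, mul_zero]; exact mul_nonneg (hUb0 p.1 (by omega)) (hUb0 0 (by omega))
        exact mul_le_mul (hlow p.1 (by omega)) (hlow p.2 (by omega)) (nonneg he hc _ s hs.1.le) (hUb0 p.1 (by omega))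
      have h2 := conv_pole_excess_le (U := Ub) (X := Xb) hρs hB.le k hUb0 hXb0 hUXb
      have hXbE : ∑ i ∈ range (k + 1), Xb i ≤ E := by
        have : ∑ i ∈ range (k + 1), Xb i = ∑ i ∈ range (K₀ + 1), X i s := by
          rw [← sum_range_add_sum_Ico _ (show K₀ + 1 ≤ k + 1 by omega)]
          have e1 : ∑ i ∈ range (K₀ + 1), Xb i = ∑ i ∈ range (K₀ + 1), X i s :=
            sum_congr rfl fun i hi => by simp only [hXb, if_pos (Nat.lt_succ_iff.mp (mem_range.mp hi))]
          have e2 : ∑ i ∈ Ico (K₀ + 1) (k + 1), Xb i = 0 :=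
            sum_eq_zero fun i hi => by simp only [hXb, if_neg (show ¬ i ≤ K₀ by have := (mem_Ico.mp hi).1; omega)]
          rw [e1, e2, add_zero]
        rw [this]; exact hXE s hsI
      have hS0 : 0 ≤ ∑ i ∈ range (k + 1), Xb i := sum_nonneg fun i hi => hXb0 i (Nat.lt_succ_iff.mp (mem_range.mp hi))
      have h3 : (ρ s ^ k)⁻¹ * (B ^ 2 * (((k : ℝ) ^ 3 - k) / 6) + 2 * B * (k : ℝ) * (∑ i ∈ range (k + 1), Xb i)
            + (∑ i ∈ range (k + 1), Xb i) ^ 2)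
          ≤ (ρ s ^ k)⁻¹ * (B ^ 2 * (((k : ℝ) ^ 3 - k) / 6) + 2 * B * (k : ℝ) * E + E ^ 2) := by
        refine mul_le_mul_of_nonneg_left ?_ (by positivity)
        nlinarith [mul_le_mul hXbE hXbE hS0 hE, mul_le_mul_of_nonneg_left hXbE (by positivity : 0 ≤ 2 * B * (k : ℝ))]
      linarith
    -- the algebraic tail inequality at k (from hcond)
    have hk3 : 0 ≤ (k : ℝ) ^ 3 - k := by
      have h1 : (1 : ℝ) ≤ k := by exact_mod_cast hk1
      have hid : (k : ℝ) ^ 3 - k = (k : ℝ) * ((k : ℝ) - 1) * ((k : ℝ) + 1) := by ring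
      rw [hid]; exact mul_nonneg (mul_nonneg (by linarith) (by linarith)) (by linarith)
    have halg : (B ^ 2 * (((k : ℝ) ^ 3 - k) / 6) + 2 * B * (k : ℝ) * E + E ^ 2) / 2
        ≤ B * (k : ℝ) * (ν * (k : ℝ) ^ 2 - (k : ℝ) * (ν * g)) := by
      have h1 : E / (ν * (k : ℝ) ^ 2) ≤ E / (ν * ((K₀ : ℝ) + 1) ^ 2) := by
        apply div_le_div_of_nonneg_left hE (by positivity)
        exact mul_le_mul_of_nonneg_left (pow_le_pow_left₀ hK1.le hkK 2) hν.le
      have h2 : E ^ 2 / (2 * B * ν * (k : ℝ) ^ 3) ≤ E ^ 2 / (2 * B * ν * ((K₀ : ℝ) + 1) ^ 3) := by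
        apply div_le_div_of_nonneg_left (by positivity) (by positivity)
        exact mul_le_mul_of_nonneg_left (pow_le_pow_left₀ hK1.le hkK 3) (by positivity)
      have h3 : g / (k : ℝ) ≤ g / ((K₀ : ℝ) + 1) := div_le_div_of_nonneg_left hg hK1 hkK
      have hc' : B / (12 * ν) + E / (ν * (k : ℝ) ^ 2) + E ^ 2 / (2 * B * ν * (k : ℝ) ^ 3) + g / (k : ℝ) ≤ 1 := by linarith
      have hν0 : ν ≠ 0 := hν.ne'
      have hB0 : B ≠ 0 := hB.ne'
      have hkne : (k : ℝ) ≠ 0 := hk0.ne'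
      have key : B ^ 2 * (k : ℝ) ^ 3 / 6 + 2 * B * (k : ℝ) * E + E ^ 2 + 2 * B * ν * g * (k : ℝ) ^ 2 ≤ 2 * B * ν * (k : ℝ) ^ 3 := by
        have := mul_le_mul_of_nonneg_left hc' (by positivity : (0 : ℝ) ≤ 2 * B * ν * (k : ℝ) ^ 3)
        rw [mul_one] at this
        have hid : 2 * B * ν * (k : ℝ) ^ 3 * (B / (12 * ν) + E / (ν * (k : ℝ) ^ 2) + E ^ 2 / (2 * B * ν * (k : ℝ) ^ 3) + g / (k : ℝ))
            = B ^ 2 * (k : ℝ) ^ 3 / 6 + 2 * B * (k : ℝ) * E + E ^ 2 + 2 * B * ν * g * (k : ℝ) ^ 2 := by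
          field_simp
          ring
        linarith [hid]
      have hdrop : B ^ 2 * (((k : ℝ) ^ 3 - k) / 6) ≤ B ^ 2 * (k : ℝ) ^ 3 / 6 := by
        have : 0 ≤ B ^ 2 * (k : ℝ) / 6 := by positivity
        nlinarith
      nlinarith
    -- φ monotone on [0, T]
    set P : ℝ → ℝ := fun s => B * (k : ℝ) * (exp (ν * (k : ℝ) ^ 2 * s) * (ρ s ^ k)⁻¹) with hP
    set D : ℝ → ℝ := fun s => exp (ν * (k : ℝ) ^ 2 * s) * e k s with hD
    have hPder : ∀ s ∈ Ioo 0 T, HasDerivAt P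
        (B * (k : ℝ) * (exp (ν * (k : ℝ) ^ 2 * s) * (ν * (k : ℝ) ^ 2) * (ρ s ^ k)⁻¹
          + exp (ν * (k : ℝ) ^ 2 * s) * (-((k : ℝ) * ρ s ^ (k - 1) * ρ' s) / (ρ s ^ k) ^ 2))) s := by
      intro s hs
      have hρs : 0 < ρ s := hρpos s ⟨hs.1.le, hs.2.le⟩
      have h1 : HasDerivAt (fun s => exp (ν * (k : ℝ) ^ 2 * s)) (exp (ν * (k : ℝ) ^ 2 * s) * (ν * (k : ℝ) ^ 2)) s := by
        have := ((hasDerivAt_id s).const_mul (ν * (k : ℝ) ^ 2)).exp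
        simpa using this
      have h2 : HasDerivAt (fun s => (ρ s ^ k)⁻¹) (-((k : ℝ) * ρ s ^ (k - 1) * ρ' s) / (ρ s ^ k) ^ 2) s :=
        ((hρder s hs).fun_pow k).inv (pow_ne_zero k hρs.ne')
      exact (h1.fun_mul h2).const_mul (B * (k : ℝ))
    have hmono : MonotoneOn (fun s => P s - D s) (Icc 0 T) := by
      refine monotoneOn_of_hasDerivWithinAt_nonneg
        (f' := fun s => B * (k : ℝ) * (exp (ν * (k : ℝ) ^ 2 * s) * (ν * (k : ℝ) ^ 2) * (ρ s ^ k)⁻¹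
            + exp (ν * (k : ℝ) ^ 2 * s) * (-((k : ℝ) * ρ s ^ (k - 1) * ρ' s) / (ρ s ^ k) ^ 2))
          - exp (ν * (k : ℝ) ^ 2 * s) * ((1 / 2) * ∑ p ∈ antidiagonal k, e p.1 s * e p.2 s))
        (convex_Icc 0 T) ?_ (fun s hs => ?_) (fun s hs => ?_)
      · refine ContinuousOn.sub ?_ ((continuousOn_weighted he k).mono (fun s hs => hs.1))
        refine ContinuousOn.mul continuousOn_const (ContinuousOn.mul (Continuous.continuousOn ?_) ?_)
        · exact continuous_exp.comp (continuous_const.mul continuous_id)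
        · exact ContinuousOn.inv₀ (hρcont.pow k) (fun s hs => pow_ne_zero k (hρpos s hs).ne')
      · rw [interior_Icc] at hs ⊢
        exact ((hPder s hs).sub (hasDerivAt_weighted he k hs.1)).hasDerivWithinAt
      · rw [interior_Icc] at hs
        have hρs : 0 < ρ s := hρpos s ⟨hs.1.le, hs.2.le⟩
        have hE1 : 0 < exp (ν * (k : ℝ) ^ 2 * s) := exp_pos _
        have hc' := hconv s hs
        have hρ's := hρ' s hs
        -- P' = B k e^{νk²s} ρ^{-k} (νk² − k ρ'/ρ) ≥ B k e^{νk²s} ρ^{-k} (νk² − k ν g)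
        have hρk : 0 < ρ s ^ k := pow_pos hρs k
        have hid : -((k : ℝ) * ρ s ^ (k - 1) * ρ' s) / (ρ s ^ k) ^ 2 = -((k : ℝ) * ρ' s / ρ s) * (ρ s ^ k)⁻¹ := by
          have hk' : ρ s ^ k = ρ s ^ (k - 1) * ρ s := by
            rw [← pow_succ]; congr 1; omega
          field_simp
          rw [hk']; ring
        rw [hid]
        have hratio : (k : ℝ) * ρ' s / ρ s ≤ (k : ℝ) * (ν * g) := by
          rw [mul_div_assoc]
          exact mul_le_mul_of_nonneg_left ((div_le_iff₀ hρs).mpr (by linarith)) hk0.le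
        -- lower bound for the derivative
        have hlow : B * (k : ℝ) * (exp (ν * (k : ℝ) ^ 2 * s) * (ν * (k : ℝ) ^ 2) * (ρ s ^ k)⁻¹
              + exp (ν * (k : ℝ) ^ 2 * s) * (-((k : ℝ) * ρ' s / ρ s) * (ρ s ^ k)⁻¹))
            ≥ exp (ν * (k : ℝ) ^ 2 * s) * (ρ s ^ k)⁻¹ * (B * (k : ℝ) * (ν * (k : ℝ) ^ 2 - (k : ℝ) * (ν * g))) := by
          have hfac : B * (k : ℝ) * (exp (ν * (k : ℝ) ^ 2 * s) * (ν * (k : ℝ) ^ 2) * (ρ s ^ k)⁻¹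
                + exp (ν * (k : ℝ) ^ 2 * s) * (-((k : ℝ) * ρ' s / ρ s) * (ρ s ^ k)⁻¹))
              = exp (ν * (k : ℝ) ^ 2 * s) * (ρ s ^ k)⁻¹ * (B * (k : ℝ) * (ν * (k : ℝ) ^ 2 - (k : ℝ) * ρ' s / ρ s)) := by ring
          rw [hfac]
          refine mul_le_mul_of_nonneg_left ?_ (by positivity)
          exact mul_le_mul_of_nonneg_left (by linarith) (by positivity)
        have hup : exp (ν * (k : ℝ) ^ 2 * s) * ((1 / 2) * ∑ p ∈ antidiagonal k, e p.1 s * e p.2 s)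
            ≤ exp (ν * (k : ℝ) ^ 2 * s) * (ρ s ^ k)⁻¹ * (B * (k : ℝ) * (ν * (k : ℝ) ^ 2 - (k : ℝ) * (ν * g))) := by
          have h1 : (1 / 2) * ∑ p ∈ antidiagonal k, e p.1 s * e p.2 s
              ≤ (ρ s ^ k)⁻¹ * ((B ^ 2 * (((k : ℝ) ^ 3 - k) / 6) + 2 * B * (k : ℝ) * E + E ^ 2) / 2) := by
            have := mul_le_mul_of_nonneg_left hc' (by norm_num : (0 : ℝ) ≤ 1 / 2)
            linarith
          have h2 : (ρ s ^ k)⁻¹ * ((B ^ 2 * (((k : ℝ) ^ 3 - k) / 6) + 2 * B * (k : ℝ) * E + E ^ 2) / 2)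
              ≤ (ρ s ^ k)⁻¹ * (B * (k : ℝ) * (ν * (k : ℝ) ^ 2 - (k : ℝ) * (ν * g))) :=
            mul_le_mul_of_nonneg_left halg (by positivity)
          calc exp (ν * (k : ℝ) ^ 2 * s) * ((1 / 2) * ∑ p ∈ antidiagonal k, e p.1 s * e p.2 s)
              ≤ exp (ν * (k : ℝ) ^ 2 * s) * ((ρ s ^ k)⁻¹ * (B * (k : ℝ) * (ν * (k : ℝ) ^ 2 - (k : ℝ) * (ν * g)))) :=
                mul_le_mul_of_nonneg_left (le_trans h1 h2) hE1.le
            _ = _ := by ring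
        linarith
    -- conclude from φ(t) ≥ φ(0) ≥ 0
    have hφ := hmono ⟨le_rfl, hT.le⟩ ht ht.1
    have hρ0 : 0 < ρ 0 := hρpos 0 ⟨le_rfl, hT.le⟩
    have hP0 : 0 ≤ P 0 - D 0 := by
      simp only [hP, hD, mul_zero, exp_zero, one_mul, he.init_zero k hk2, mul_zero, sub_zero]
      positivity
    have hPD : D t ≤ P t := by simp only at hφ; linarith
    have hρt : 0 < ρ t := hρpos t ht
    have hEt : 0 < exp (ν * (k : ℝ) ^ 2 * t) := exp_pos _
    have : exp (ν * (k : ℝ) ^ 2 * t) * e k t ≤ exp (ν * (k : ℝ) ^ 2 * t) * (B * (k : ℝ) * (ρ t ^ k)⁻¹) := by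
      have h := hPD; simp only [hP, hD] at h; linarith
    exact le_of_mul_le_mul_left this hEt

end SheetNSLineTorusCascade
end Summit.NavierStokesRegularity.OSWSelfSimilar
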